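import Summits.RiemannHypothesis.RiemannHypothesis.Theorems.RuelleBandCofiniteCriticalLineStubCalibrationENDOfRH
import Summits.RiemannHypothesis.RiemannHypothesis.Theorems.RuelleBandCofiniteCriticalLineStubPolarZeroForm
import HarnessLib

set_option linter.dupNamespace false

/-!
# Calibration `crux ⟹ END` of line `cofinite-weil-index-staircase` — auxiliary file

Crux `Summit.RiemannHypothesis.RiemannHypothesis.Theses.RuelleBand.CofiniteCriticalLine` (item
stmt-RiemannHypothesis-2064), line `cofinite-weil-index-staircase`, lead c2 (2026-08-16).  The line's bet END
(`stub_eventuallyNondegenerate`) implies the crux through the landed stubs; this file and its sequel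
certify the CONVERSE `crux ⟹ END` (modulo the unconditional named fact `Anderson1983_levinson_simple`).
Here: the zero-side bookkeeping relative to a finite set `E` of non-trivial zeros containing every
off-line zero (`hE : ρ ∉ E → Re ρ = 1/2`); `m = riemannZetaZeroOrder`, `ĝ = weilMellin g`,
`Q = weilQuadratic`, `W = weilFunctional`:

* `…_tendsto_re_weilQuadratic` — `Re Q(gₙ) → 0` for a form-Cauchy sequence with `W(gₙ ⋆ g̃ₘ) → 0`
  (NO positivity: `Qₙ + Qₘ = Re Q(gₙ − gₘ) + 2 Re W(gₙ ⋆ g̃ₘ)` is small for `n ≫ m ≫ 1`, and three such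
  relations isolate `Qₘ`);
* `…_re_weilQuadratic_eq` — the split `Re Q(g) = Re Σ_{ρ∈E} m(ρ) ĝ(ρ) conj ĝ(1−ρ̄) + P_E(g)` with the
  ON-LINE ENERGY `P_E(g) = Σ'_{ρ∉E} m(ρ) |ĝ(ρ)|² ≥ 0` (`stub_cofiniteWeilCriterion_zeroForm_eq`);
* `…_norm_sub_polarE_le` — the polar version: `|W(g ⋆ h̃) − Σ_{ρ∈E} m(ρ) ĝ(ρ) conj ĥ(1−ρ̄)| ≤
  (t P_E(g) + P_E(h)/t)/2` for every `t > 0` (Stub C1 `stub_polarZeroForm` + `2ab ≤ ta² + b²/t`);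
* `…_sq_le_mul_of_forall` — `(∀ t > 0, 2x ≤ tA + B/t) ⇒ x² ≤ AB`;
* translation lemmas: support of `φ(· − x)`, `P_E(φ(· − x)) = P_E(φ)` (`|e^{(ρ−1/2)x}| = 1` on the
  line), and the off-line pairing of a translate as an exponential polynomial in `x`.
-/

noncomputable section

open Complex MeasureTheory Filter Set
open scoped BigOperators Topology ComplexConjugate

namespace Summit.RiemannHypothesis.RiemannHypothesis.Theorems.RuelleBandCofiniteCriticalLine

open Literature.NumberTheory.LFunctions

/-! ### (1) `Re Q(gₙ) → 0` without positivity -/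

/-- **`Re Q(gₙ) → 0` for a form-Cauchy sequence orthogonal in the limit to each of its members**, with
no sign assumption on `Q`: from `Re Q(gₙ − gₘ) = Re Q(gₙ) + Re Q(gₘ) − 2 Re W(gₙ ⋆ g̃ₘ)`
(`stub_calibration_END_of_RH_re_weilQuadratic_sub`) the sums `Qₙ + Qₘ` are small whenever `m` is large
and `n` is large depending on `m`; three such relations (`(n, M₀)`, `(n, m)`, `(m, M₀)`) give
`2 Qₘ = (Qₘ + Q_{M₀}) + (Qₙ + Qₘ) − (Qₙ + Q_{M₀})` small. (Curried form; the registered anchor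
`stub_calibration_END_of_cofinite_tendsto_re_weilQuadratic` below restates it uncurried.) [folklore] -/
theorem stub_calibration_END_of_cofinite_tendsto_re_weilQuadratic' {g : ℕ → ℝ → ℂ}
    (hg : ∀ n, IsWeilTest (g n))
    (hC : Tendsto (fun q : ℕ × ℕ => (weilQuadratic (g q.1 - g q.2)).re) atTop (𝓝 0))
    (hW : ∀ m, Tendsto (fun n => weilFunctional (weilConv (g n) (weilReflect (g m))))
      atTop (𝓝 0)) :
    Tendsto (fun n => (weilQuadratic (g n)).re) atTop (𝓝 0) := by
  rw [Metric.tendsto_atTop]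
  intro ε hε
  have h1 : ∀ᶠ q : ℕ × ℕ in atTop, |(weilQuadratic (g q.1 - g q.2)).re| < ε / 5 := by
    have := (Metric.tendsto_nhds.1 hC) (ε / 5) (by positivity)
    simpa [Real.dist_eq] using this
  obtain ⟨M₀, hM₀⟩ := eventually_atTop_prod_self.1 h1
  have hN : ∀ m, ∃ N, ∀ n, N ≤ n →
      ‖weilFunctional (weilConv (g n) (weilReflect (g m)))‖ < ε / 5 := by
    intro m
    obtain ⟨N, hN⟩ := (Metric.tendsto_atTop.1 (hW m)) (ε / 5) (by positivity)
    exact ⟨N, fun n hn => by simpa [dist_zero_right] using hN n hn⟩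
  choose N hN using hN
  have key : ∀ m n, M₀ ≤ m → M₀ ≤ n → N m ≤ n →
      |(weilQuadratic (g n)).re + (weilQuadratic (g m)).re| < 3 * (ε / 5) := by
    intro m n hm hn hnN
    have hq : |(weilQuadratic (g n - g m)).re| < ε / 5 := hM₀ n m hn hm
    have hbre : |(weilFunctional (weilConv (g n) (weilReflect (g m)))).re| < ε / 5 :=
      (abs_re_le_norm _).trans_lt (hN m n hnN)
    have hexp := stub_calibration_END_of_RH_re_weilQuadratic_sub (hg n) (hg m)
    rw [abs_lt] at hq hbre ⊢
    constructor <;> linarith [hq.1, hq.2, hbre.1, hbre.2]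
  refine ⟨max M₀ (N M₀), fun m hm => ?_⟩
  have hmM : M₀ ≤ m := le_of_max_le_left hm
  have hmN : N M₀ ≤ m := le_of_max_le_right hm
  set n := max (max M₀ (N M₀)) (N m) with hn
  have hnM : M₀ ≤ n := (le_max_left _ _).trans (le_max_left _ _)
  have hnN0 : N M₀ ≤ n := (le_max_right _ _).trans (le_max_left _ _)
  have hnNm : N m ≤ n := le_max_right _ _
  have e1 := key M₀ n le_rfl hnM hnN0
  have e2 := key m n hmM hnM hnNm
  have e3 := key M₀ m le_rfl hmM hmN
  rw [Real.dist_eq, sub_zero, abs_lt]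
  rw [abs_lt] at e1 e2 e3
  constructor <;> linarith [e1.1, e1.2, e2.1, e2.2, e3.1, e3.2]

/-- **Registered anchor (uncurried form): `Re Q(gₙ) → 0` for a form-Cauchy sequence with
`W(gₙ ⋆ g̃ₘ) → 0`, without positivity.** [folklore] -/
theorem stub_calibration_END_of_cofinite_tendsto_re_weilQuadratic : ∀ {g : ℕ → ℝ → ℂ},
    (∀ n, IsWeilTest (g n)) →
    Tendsto (fun q : ℕ × ℕ => (weilQuadratic (g q.1 - g q.2)).re) atTop (𝓝 0) →
    (∀ m, Tendsto (fun n => weilFunctional (weilConv (g n) (weilReflect (g m)))) atTop (𝓝 0)) →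
    Tendsto (fun n => (weilQuadratic (g n)).re) atTop (𝓝 0) :=
  fun hg hC hW => stub_calibration_END_of_cofinite_tendsto_re_weilQuadratic' hg hC hW

/-! ### (2) The on-line energy relative to a finite exceptional set `E` -/

variable (E : Finset ZetaZeros.riemannZetaNontrivialZeros)

/-- **On-line terms are squared moduli.** Off the exceptional set (`Re ρ = 1/2`, so `1 − ρ̄ = ρ`):
`m(ρ) ĝ(ρ) conj ĝ(1 − ρ̄) = m(ρ) |ĝ(ρ)|²` as a real number cast to `ℂ`. [folklore] -/
theorem stub_calibration_END_of_cofinite_term_onLine {ρ : ZetaZeros.riemannZetaNontrivialZeros}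
    (hρ : (ρ : ℂ).re = 1 / 2) (g h : ℝ → ℂ) :
    (riemannZetaZeroOrder (ρ : ℂ) : ℂ) * (weilMellin g ρ * conj (weilMellin h (1 - conj (ρ : ℂ)))) =
      (riemannZetaZeroOrder (ρ : ℂ) : ℂ) * (weilMellin g ρ * conj (weilMellin h ρ)) := by
  have h1 : 1 - conj (ρ : ℂ) = ρ := by
    apply Complex.ext
    · simp only [sub_re, one_re, conj_re, hρ]; norm_num
    · simp
  rw [h1]

/-- **Summability of the on-line energy** `P_E(g) = Σ'_{ρ ∉ E} m(ρ)|ĝ(ρ)|²` (written as a `tsum` over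
all non-trivial zeros of `if ρ ∈ E then 0 else m(ρ)|ĝ(ρ)|²`): dominated by `m(ρ) C_g²/(1 + γ²)²`
(`norm_weilMellin_le`, `summable_norm_zeroSide_of_le`). [folklore] -/
theorem stub_calibration_END_of_cofinite_summable_onLine {g : ℝ → ℂ} (hg : IsWeilTest g) :
    Summable fun ρ : ZetaZeros.riemannZetaNontrivialZeros =>
      if ρ ∈ E then (0 : ℝ) else (riemannZetaZeroOrder (ρ : ℂ) : ℝ) * ‖weilMellin g ρ‖ ^ 2 := by
  have hs : Summable fun ρ : ZetaZeros.riemannZetaNontrivialZeros =>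
      ‖(riemannZetaZeroOrder (ρ : ℂ) : ℂ) * (weilMellin g ρ * conj (weilMellin g ρ))‖ := by
    refine summable_norm_zeroSide_of_le (a := fun ρ ↦ weilMellin g ρ * conj (weilMellin g ρ))
      (K := weilDecayConst g ^ 2) fun ρ hρ ↦ ?_
    have h1 : ‖weilMellin g ρ‖ ≤ weilDecayConst g / (1 + ρ.im ^ 2) :=
      norm_weilMellin_le hg (ZetaZeros.riemannZetaNontrivialZeros.re_pos hρ).le
        (ZetaZeros.riemannZetaNontrivialZeros.re_lt_one hρ).le
    have h0 : 0 ≤ ‖weilMellin g ρ‖ := norm_nonneg _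
    rw [norm_mul, Complex.norm_conj]
    calc ‖weilMellin g ρ‖ * ‖weilMellin g ρ‖
        ≤ (weilDecayConst g / (1 + ρ.im ^ 2)) * (weilDecayConst g / (1 + ρ.im ^ 2)) :=
          mul_le_mul h1 h1 h0 (h0.trans h1)
      _ = weilDecayConst g ^ 2 / (1 + ρ.im ^ 2) ^ 2 := by rw [div_mul_div_comm, ← sq, ← sq]
  have hm0 : ∀ ρ : ZetaZeros.riemannZetaNontrivialZeros, (0 : ℝ) ≤ riemannZetaZeroOrder (ρ : ℂ) :=
    fun ρ => by
      exact_mod_cast le_trans zero_le_one (ZetaZeros.riemannZetaNontrivialZeros.one_le_order ρ.2)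
  refine Summable.of_nonneg_of_le (fun ρ => ?_) (fun ρ => ?_) hs
  · split_ifs
    · exact le_rfl
    · exact mul_nonneg (hm0 ρ) (sq_nonneg _)
  · split_ifs
    · exact norm_nonneg _
    · rw [norm_mul, norm_mul, Complex.norm_conj, Complex.norm_intCast, abs_of_nonneg (hm0 ρ), sq]

/-- The on-line energy is non-negative. [folklore] -/
theorem stub_calibration_END_of_cofinite_onLine_nonneg (g : ℝ → ℂ) :
    0 ≤ ∑' ρ : ZetaZeros.riemannZetaNontrivialZeros,
      (if ρ ∈ E then (0 : ℝ) else (riemannZetaZeroOrder (ρ : ℂ) : ℝ) * ‖weilMellin g ρ‖ ^ 2) := by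
  refine tsum_nonneg fun ρ => ?_
  split_ifs
  · exact le_rfl
  · refine mul_nonneg ?_ (sq_nonneg _)
    exact_mod_cast le_trans zero_le_one (ZetaZeros.riemannZetaNontrivialZeros.one_le_order ρ.2)

/-- A single on-line term is bounded by the on-line energy: for `ρ ∉ E`,
`m(ρ)|ĝ(ρ)|² ≤ P_E(g)`. [folklore] -/
theorem stub_calibration_END_of_cofinite_term_le_onLine {g : ℝ → ℂ} (hg : IsWeilTest g)
    {ρ : ZetaZeros.riemannZetaNontrivialZeros} (hρ : ρ ∉ E) :
    (riemannZetaZeroOrder (ρ : ℂ) : ℝ) * ‖weilMellin g ρ‖ ^ 2 ≤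
      ∑' ρ : ZetaZeros.riemannZetaNontrivialZeros,
        (if ρ ∈ E then (0 : ℝ) else (riemannZetaZeroOrder (ρ : ℂ) : ℝ) * ‖weilMellin g ρ‖ ^ 2) := by
  have h := (stub_calibration_END_of_cofinite_summable_onLine E hg).le_tsum ρ (fun ρ' _ => by
    split_ifs
    · exact le_rfl
    · refine mul_nonneg ?_ (sq_nonneg _)
      exact_mod_cast le_trans zero_le_one (ZetaZeros.riemannZetaNontrivialZeros.one_le_order ρ'.2))
  simpa [hρ] using h

variable {E}

/-- **Splitting a zero sum along `E`.** For a summable family over the non-trivial zeros,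
`Σ' f = Σ_{ρ∈E} f(ρ) + Σ' (if ρ ∈ E then 0 else f ρ)`. [folklore] -/
theorem stub_calibration_END_of_cofinite_tsum_split
    {f : ZetaZeros.riemannZetaNontrivialZeros → ℂ} (hf : Summable f) :
    ∑' ρ, f ρ = ∑ ρ ∈ E, f ρ + ∑' ρ, (if ρ ∈ E then 0 else f ρ) := by
  classical
  have hfirst : Summable fun ρ : ZetaZeros.riemannZetaNontrivialZeros => if ρ ∈ E then f ρ else 0 :=
    summable_of_ne_finset_zero (s := E) fun ρ hρ => by simp [hρ]
  have hsecond : Summable fun ρ : ZetaZeros.riemannZetaNontrivialZeros => if ρ ∈ E then 0 else f ρ := by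
    have e : (fun ρ : ZetaZeros.riemannZetaNontrivialZeros => if ρ ∈ E then 0 else f ρ) =
        fun ρ => f ρ - (if ρ ∈ E then f ρ else 0) := by
      funext ρ; split_ifs <;> simp
    rw [e]
    exact hf.sub hfirst
  have e : (fun ρ => f ρ) = fun ρ => (if ρ ∈ E then f ρ else 0) + (if ρ ∈ E then 0 else f ρ) := by
    funext ρ; split_ifs <;> simp
  calc ∑' ρ, f ρ = ∑' ρ, ((if ρ ∈ E then f ρ else 0) + (if ρ ∈ E then 0 else f ρ)) := by rw [e]
    _ = ∑' ρ, (if ρ ∈ E then f ρ else 0) + ∑' ρ, (if ρ ∈ E then 0 else f ρ) :=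
        hfirst.tsum_add hsecond
    _ = ∑ ρ ∈ E, f ρ + ∑' ρ, (if ρ ∈ E then 0 else f ρ) := by
        congr 1
        rw [tsum_eq_sum (s := E) (fun ρ hρ => by simp [hρ])]
        exact Finset.sum_congr rfl fun ρ hρ => by simp [hρ]

/-- **The split of `Re Q` along `E`.** If every zero outside `E` is on the critical line, then for a
test function `g`: `Re Q(g) = Re Σ_{ρ∈E} m(ρ) ĝ(ρ) conj ĝ(1 − ρ̄) + P_E(g)` — the explicit formula on
the zero side (`stub_cofiniteWeilCriterion_zeroForm_eq`: `Q(g) = Σ' m(ρ) ĝ(ρ) conj ĝ(1 − ρ̄)`) split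
along `E`, with the on-line terms `m(ρ)|ĝ(ρ)|²`. [folklore] -/
theorem stub_calibration_END_of_cofinite_re_weilQuadratic_eq
    (hE : ∀ ρ : ZetaZeros.riemannZetaNontrivialZeros, ρ ∉ E → (ρ : ℂ).re = 1 / 2)
    {g : ℝ → ℂ} (hg : IsWeilTest g) :
    (weilQuadratic g).re =
      (∑ ρ ∈ E, (riemannZetaZeroOrder (ρ : ℂ) : ℂ) *
          (weilMellin g ρ * conj (weilMellin g (1 - conj (ρ : ℂ))))).re +
      ∑' ρ : ZetaZeros.riemannZetaNontrivialZeros,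
        (if ρ ∈ E then (0 : ℝ) else (riemannZetaZeroOrder (ρ : ℂ) : ℝ) * ‖weilMellin g ρ‖ ^ 2) := by
  classical
  have hzf := stub_cofiniteWeilCriterion_zeroForm_eq hg
  have hsum : Summable fun ρ : ZetaZeros.riemannZetaNontrivialZeros =>
      (riemannZetaZeroOrder (ρ : ℂ) : ℂ) * (weilMellin g ρ * conj (weilMellin g (1 - conj (ρ : ℂ)))) :=
    WeilConverse.summable_pairCoeff hg
  have hsplit := stub_calibration_END_of_cofinite_tsum_split (E := E) hsum
  have hterm : ∀ ρ : ZetaZeros.riemannZetaNontrivialZeros,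
      (if ρ ∈ E then (0 : ℂ) else
        (riemannZetaZeroOrder (ρ : ℂ) : ℂ) * (weilMellin g ρ * conj (weilMellin g (1 - conj (ρ : ℂ))))) =
      ((if ρ ∈ E then (0 : ℝ) else (riemannZetaZeroOrder (ρ : ℂ) : ℝ) * ‖weilMellin g ρ‖ ^ 2 : ℝ) : ℂ) := by
    intro ρ
    split_ifs with hρ
    · simp
    · rw [stub_calibration_END_of_cofinite_term_onLine (hE ρ hρ), Complex.mul_conj,
        Complex.normSq_eq_norm_sq]
      push_cast
      ring
  have hre : (∑' ρ : ZetaZeros.riemannZetaNontrivialZeros,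
      (if ρ ∈ E then (0 : ℂ) else
        (riemannZetaZeroOrder (ρ : ℂ) : ℂ) * (weilMellin g ρ * conj (weilMellin g (1 - conj (ρ : ℂ)))))) =
      ((∑' ρ : ZetaZeros.riemannZetaNontrivialZeros,
        (if ρ ∈ E then (0 : ℝ) else (riemannZetaZeroOrder (ρ : ℂ) : ℝ) * ‖weilMellin g ρ‖ ^ 2) : ℝ) : ℂ) := by
    rw [Complex.ofReal_tsum]
    exact tsum_congr hterm
  have hQ : weilQuadratic g = ∑ ρ ∈ E, (riemannZetaZeroOrder (ρ : ℂ) : ℂ) *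
      (weilMellin g ρ * conj (weilMellin g (1 - conj (ρ : ℂ)))) +
      ((∑' ρ : ZetaZeros.riemannZetaNontrivialZeros,
        (if ρ ∈ E then (0 : ℝ) else (riemannZetaZeroOrder (ρ : ℂ) : ℝ) * ‖weilMellin g ρ‖ ^ 2) : ℝ) : ℂ) := by
    rw [← hzf, WeilConverse.zeroForm, ← hre]
    exact hsplit
  rw [hQ, Complex.add_re, Complex.ofReal_re]

/-! ### (3) The polar split and the Cauchy–Schwarz-type bound on the on-line part -/

/-- `2ab ≤ t a² + b²/t` for `t > 0` (`0 ≤ (ta − b)²`). [folklore] -/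
theorem stub_calibration_END_of_cofinite_two_mul_le {a b t : ℝ} (ht : 0 < t) :
    2 * a * b ≤ t * a ^ 2 + b ^ 2 / t := by
  rw [← sub_nonneg]
  have e : t * a ^ 2 + b ^ 2 / t - 2 * a * b = (t * a - b) ^ 2 / t := by
    field_simp
    ring
  rw [e]
  positivity

/-- **Polar split with the on-line part bounded.** If every zero outside `E` is on the line, then for
test functions `g, h` and every `t > 0`:
`|W(g ⋆ h̃) − Σ_{ρ∈E} m(ρ) ĝ(ρ) conj ĥ(1 − ρ̄)| ≤ (t P_E(g) + P_E(h)/t)/2` — Stub C1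
(`stub_polarZeroForm`) splits `W(g ⋆ h̃)` along `E`; off `E` the terms are `m(ρ) ĝ(ρ) conj ĥ(ρ)`, of
modulus `≤ m(ρ)(t|ĝ(ρ)|² + |ĥ(ρ)|²/t)/2`. [folklore] -/
theorem stub_calibration_END_of_cofinite_norm_sub_polarE_le
    (hE : ∀ ρ : ZetaZeros.riemannZetaNontrivialZeros, ρ ∉ E → (ρ : ℂ).re = 1 / 2)
    {g h : ℝ → ℂ} (hg : IsWeilTest g) (hh : IsWeilTest h) {t : ℝ} (ht : 0 < t) :
    ‖weilFunctional (weilConv g (weilReflect h)) -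
        ∑ ρ ∈ E, (riemannZetaZeroOrder (ρ : ℂ) : ℂ) *
          (weilMellin g ρ * conj (weilMellin h (1 - conj (ρ : ℂ))))‖ ≤
      (t * (∑' ρ : ZetaZeros.riemannZetaNontrivialZeros,
          (if ρ ∈ E then (0 : ℝ) else (riemannZetaZeroOrder (ρ : ℂ) : ℝ) * ‖weilMellin g ρ‖ ^ 2)) +
        (∑' ρ : ZetaZeros.riemannZetaNontrivialZeros,
          (if ρ ∈ E then (0 : ℝ) else (riemannZetaZeroOrder (ρ : ℂ) : ℝ) * ‖weilMellin h ρ‖ ^ 2)) / t)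
        / 2 := by
  classical
  obtain ⟨hsumN, heq⟩ := stub_polarZeroForm hg hh
  set F : ZetaZeros.riemannZetaNontrivialZeros → ℂ := fun ρ =>
    (riemannZetaZeroOrder (ρ : ℂ) : ℂ) * (weilMellin g ρ * conj (weilMellin h (1 - conj (ρ : ℂ))))
    with hF
  set A : ZetaZeros.riemannZetaNontrivialZeros → ℝ := fun ρ =>
    if ρ ∈ E then (0 : ℝ) else (riemannZetaZeroOrder (ρ : ℂ) : ℝ) * ‖weilMellin g ρ‖ ^ 2 with hA
  set B : ZetaZeros.riemannZetaNontrivialZeros → ℝ := fun ρ =>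
    if ρ ∈ E then (0 : ℝ) else (riemannZetaZeroOrder (ρ : ℂ) : ℝ) * ‖weilMellin h ρ‖ ^ 2 with hB
  have hsum : Summable F := hsumN.of_norm
  have hsplit := stub_calibration_END_of_cofinite_tsum_split (E := E) hsum
  have hdiff : weilFunctional (weilConv g (weilReflect h)) - ∑ ρ ∈ E, F ρ =
      ∑' ρ, (if ρ ∈ E then 0 else F ρ) := by
    rw [heq]
    change ∑' ρ, F ρ - ∑ ρ ∈ E, F ρ = _
    rw [hsplit]
    ring
  have hm0 : ∀ ρ : ZetaZeros.riemannZetaNontrivialZeros, (0 : ℝ) ≤ riemannZetaZeroOrder (ρ : ℂ) :=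
    fun ρ => by
      exact_mod_cast le_trans zero_le_one (ZetaZeros.riemannZetaNontrivialZeros.one_le_order ρ.2)
  -- pointwise bound on the norms of the remaining terms
  have hpt : ∀ ρ : ZetaZeros.riemannZetaNontrivialZeros,
      ‖(if ρ ∈ E then 0 else F ρ)‖ ≤ t / 2 * A ρ + 1 / (2 * t) * B ρ := by
    intro ρ
    by_cases hρ : ρ ∈ E
    · simp [hρ, hA, hB]
    · simp only [hρ, if_false, hA, hB, hF]
      rw [stub_calibration_END_of_cofinite_term_onLine (hE ρ hρ), norm_mul, norm_mul,
        Complex.norm_conj, Complex.norm_intCast, abs_of_nonneg (hm0 ρ)]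
      have h2 := stub_calibration_END_of_cofinite_two_mul_le (a := ‖weilMellin g ρ‖)
        (b := ‖weilMellin h ρ‖) ht
      have hm := hm0 ρ
      have e : t / 2 * ((riemannZetaZeroOrder (ρ : ℂ) : ℝ) * ‖weilMellin g ρ‖ ^ 2) +
          1 / (2 * t) * ((riemannZetaZeroOrder (ρ : ℂ) : ℝ) * ‖weilMellin h ρ‖ ^ 2) =
          (riemannZetaZeroOrder (ρ : ℂ) : ℝ) * ((t * ‖weilMellin g ρ‖ ^ 2 + ‖weilMellin h ρ‖ ^ 2 / t) / 2) := by
        field_simp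
      rw [e]
      refine mul_le_mul_of_nonneg_left ?_ hm
      linarith
  have hsA : Summable A := stub_calibration_END_of_cofinite_summable_onLine E hg
  have hsB : Summable B := stub_calibration_END_of_cofinite_summable_onLine E hh
  have hsR : Summable fun ρ => t / 2 * A ρ + 1 / (2 * t) * B ρ :=
    (hsA.mul_left _).add (hsB.mul_left _)
  have hsN : Summable fun ρ : ZetaZeros.riemannZetaNontrivialZeros => ‖(if ρ ∈ E then 0 else F ρ)‖ :=
    Summable.of_nonneg_of_le (fun _ => norm_nonneg _) hpt hsR
  rw [hdiff]
  calc ‖∑' ρ, (if ρ ∈ E then 0 else F ρ)‖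
      ≤ ∑' ρ, ‖(if ρ ∈ E then 0 else F ρ)‖ := norm_tsum_le_tsum_norm hsN
    _ ≤ ∑' ρ, (t / 2 * A ρ + 1 / (2 * t) * B ρ) := hsN.tsum_le_tsum hpt hsR
    _ = t / 2 * ∑' ρ, A ρ + 1 / (2 * t) * ∑' ρ, B ρ := by
        rw [(hsA.mul_left _).tsum_add (hsB.mul_left _), tsum_mul_left, tsum_mul_left]
    _ = (t * ∑' ρ, A ρ + (∑' ρ, B ρ) / t) / 2 := by
        field_simp

/-- **From `2x ≤ tA + B/t` for all `t > 0` to `x² ≤ AB`** (`x, A, B ≥ 0`; optimise `t`, with the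
degenerate cases `A = 0`, `x = 0` separately). [folklore] -/
theorem stub_calibration_END_of_cofinite_sq_le_mul_of_forall {x A B : ℝ} (hx : 0 ≤ x) (hA : 0 ≤ A)
    (hB : 0 ≤ B) (h : ∀ t : ℝ, 0 < t → 2 * x ≤ t * A + B / t) : x ^ 2 ≤ A * B := by
  rcases hx.eq_or_lt with hx0 | hx0
  · rw [← hx0, zero_pow two_ne_zero]; positivity
  rcases hA.eq_or_lt with hA0 | hA0
  · -- `A = 0`: `2x ≤ B/t` for all `t`, impossible for `x > 0`
    exfalso
    have ht : 0 < B / x + 1 := by positivity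
    have h1 := h (B / x + 1) ht
    rw [← hA0, mul_zero, zero_add] at h1
    have h2 : B / (B / x + 1) < x := by
      rw [div_lt_iff₀ ht]
      have : x * (B / x + 1) = B + x := by field_simp
      linarith
    linarith
  · have ht : 0 < x / A := div_pos hx0 hA0
    have h1 := h (x / A) ht
    have e1 : x / A * A = x := by field_simp
    have e2 : B / (x / A) = A * B / x := by field_simp
    rw [e1, e2] at h1
    have h3 : x ≤ A * B / x := by linarith
    rwa [le_div_iff₀ hx0, ← sq] at h3

/-! ### (4) Translation inside the window -/

/-- Support of a translate: if `tsupport φ ⊆ [−R, R]` then `tsupport φ(· − x) ⊆ [−R + x, R + x]`.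
[folklore] -/
theorem stub_calibration_END_of_cofinite_tsupport_weilTranslate {φ : ℝ → ℂ} {R : ℝ} (x : ℝ)
    (hφ : tsupport φ ⊆ Icc (-R) R) :
    tsupport (weilTranslate φ x) ⊆ Icc (-R + x) (R + x) := by
  refine closure_minimal (fun t ht => ?_) isClosed_Icc
  have ht' : t - x ∈ Function.support φ := by
    simpa [weilTranslate, Function.mem_support] using ht
  have hmem := hφ (subset_tsupport φ ht')
  constructor <;> linarith [hmem.1, hmem.2]

/-- **Translation does not change the on-line energy**: `P_E(φ(· − x)) = P_E(φ)` when the zeros off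
`E` are on the line (`(φ_x)^(ρ) = e^{(ρ − 1/2)x} φ̂(ρ)` by `weilMellin_weilTranslate`, and
`|e^{(ρ−1/2)x}| = 1` for `Re ρ = 1/2`). [folklore] -/
theorem stub_calibration_END_of_cofinite_onLine_weilTranslate
    (hE : ∀ ρ : ZetaZeros.riemannZetaNontrivialZeros, ρ ∉ E → (ρ : ℂ).re = 1 / 2)
    (φ : ℝ → ℂ) (x : ℝ) :
    (∑' ρ : ZetaZeros.riemannZetaNontrivialZeros,
      (if ρ ∈ E then (0 : ℝ) else
        (riemannZetaZeroOrder (ρ : ℂ) : ℝ) * ‖weilMellin (weilTranslate φ x) ρ‖ ^ 2)) =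
    ∑' ρ : ZetaZeros.riemannZetaNontrivialZeros,
      (if ρ ∈ E then (0 : ℝ) else (riemannZetaZeroOrder (ρ : ℂ) : ℝ) * ‖weilMellin φ ρ‖ ^ 2) := by
  refine tsum_congr fun ρ => ?_
  by_cases hρ : ρ ∈ E
  · simp [hρ]
  · simp only [hρ, if_false]
    rw [weilMellin_weilTranslate, norm_mul, Complex.norm_exp]
    have hre : (((ρ : ℂ) - 1 / 2) * (x : ℂ)).re = 0 := by
      rw [Complex.mul_re, Complex.ofReal_re, Complex.ofReal_im, Complex.sub_re, hE ρ hρ]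
      norm_num
    rw [hre, Real.exp_zero, one_mul]

/-- **The off-line pairing of a translate is an exponential polynomial in the shift**: for any
coefficients `w(ρ)`,
`Σ_{ρ∈E} m(ρ) w(ρ) conj((φ_x)^(1 − ρ̄)) = Σ_{ρ∈E} (m(ρ) conj φ̂(1 − ρ̄)) w(ρ) e^{(1/2 − ρ)x}`
(`(φ_x)^(s) = e^{(s−1/2)x} φ̂(s)`, `conj e^{(1/2 − ρ̄)x} = e^{(1/2 − ρ)x}` for real `x`). [folklore] -/
theorem stub_calibration_END_of_cofinite_polarE_weilTranslate (φ : ℝ → ℂ) (w : ℂ → ℂ) (x : ℝ) :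
    ∑ ρ ∈ E, (riemannZetaZeroOrder (ρ : ℂ) : ℂ) *
        (w ρ * conj (weilMellin (weilTranslate φ x) (1 - conj (ρ : ℂ)))) =
      ∑ ρ ∈ E, (riemannZetaZeroOrder (ρ : ℂ) : ℂ) * conj (weilMellin φ (1 - conj (ρ : ℂ))) * w ρ *
        cexp ((1 / 2 - (ρ : ℂ)) * x) := by
  refine Finset.sum_congr rfl fun ρ _ => ?_
  rw [weilMellin_weilTranslate, map_mul, ← Complex.exp_conj]
  have e : conj ((1 - conj (ρ : ℂ) - 1 / 2) * (x : ℂ)) = (1 / 2 - (ρ : ℂ)) * x := by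
    simp only [map_mul, map_sub, map_one, Complex.conj_conj, Complex.conj_ofReal, map_div₀,
      map_ofNat]
    ring
  rw [e]
  ring

end Summit.RiemannHypothesis.RiemannHypothesis.Theorems.RuelleBandCofiniteCriticalLine

end
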